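import Summits.BirchSwinnertonDyer.BirchSwinnertonDyer.Theorems.BiquadraticEisensteinDescentEisensteinHeartFlatCMInertBadKPrimeStubV2AllJ
import Summits.BirchSwinnertonDyer.BirchSwinnertonDyer.Theorems.BiquadraticEisensteinDescentDeuringRowZeroHolds
import HarnessLib

set_option linter.dupNamespace false -- `Summit.BirchSwinnertonDyer.BirchSwinnertonDyer.Theorems.…` (summit = sub, D-0017)
set_option autoImplicit false

/-!
# Crux `EisensteinHeartFlatCMInertBadKPrime` (stmt-BirchSwinnertonDyer-21341), line `hsieh_lambda`, road (B′):
# the TIED FRAME DATA of `stub_V2` WITHOUT the Katz–Hida–Tilouine measure — `L = K′(√d_CM)`, `Σ_p = {𝔓′}`, `S`, `T`,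
# `λ = ψ_W∘N_{L/K_CM}·‖·‖_L`, Hsieh's `ϑ`, the two places `w₁ ≠ w₂`, with (T), (C), (L), (R) and `Im σ_w(ϑ) ≠ 0` — UNCONDITIONALLY

Route `BiquadraticEisensteinDescent` (cell `pub/bsd-wall`, lead-prover seat `bsd-wall-cm-bed-p1` g7). THEOREMS ONLY; supports, does
not close, stmt-BirchSwinnertonDyer-21341. This is the width seats' `…TiedFrame.exists_tiedFrame_of_frame` (w3 g7) and
`…StubV2AllJ.stub_V2_of_katz_of_deuring` (w3 g7 / w4 g8) with the LAST STEP REMOVED: everything those theorems produce EXCEPT the Katz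
line series `G` and its constants `(C_K, Ω, Ω′_p)` — which were the only use of the named fact `hsieh2014mu_prop49_exists_isMeasure` —
and with Deuring's theorem supplied by the kernel theorem `…DeuringOfCore.Deuring_exists_heckeCharacter_of_maximalCM_holds` (p698052).
So `exists_tiedFrameData` below is UNCONDITIONAL. Purpose (lead g7, `…OfV4KOfKatzOnly` module docstring and card §v5/§v6): on the
`K′`-line the crux's own ♭-frame `Q` will serve as the Katz line series (sequel `…KatzLineFromFlat`), which retires the Katz measure from
the reduction of 21341. Proofs are the width seats' proofs verbatim minus the Katz call (credit w1–w4 g6–g8). Nothing about the crux's input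
or any case of BSD is asserted.
-/

noncomputable section

open scoped Classical NumberField IntermediateField
open NumberField IsDedekindDomain Module CongruenceSubgroup WeierstrassCurve IntermediateField Field PowerSeries
open Literature.NumberTheory.EllipticCurves Literature.NumberTheory.GaloisRepresentations
open Literature.NumberTheory.EllipticCurves.ModularForms Literature.NumberTheory.EllipticCurves.Rank1Residual


open Summit.BirchSwinnertonDyer.BirchSwinnertonDyer.Theorems.BiquadraticEisensteinDescentEisensteinHeartFlatCMInertBadKPrimeKatzHsiehLValueCM
  (hLval_of_deuring_of_cmField)
open Summit.BirchSwinnertonDyer.BirchSwinnertonDyer.Theorems.BiquadraticEisensteinDescentEisensteinHeartFlatCMInertBadKPrimeKatzTypeAtFrame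
  (exists_hT_hcont_adjoin)
open Summit.BirchSwinnertonDyer.BirchSwinnertonDyer.Theorems.BiquadraticEisensteinDescentEisensteinHeartFlatCMInertBadKPrimeFrameCMSubfield
  (not_mem_range_rat finrank_adjoin_eq_two isCMFieldOfJ_adjoin isTotallyComplex_adjoin finrank_adjoin_top_eq_two
    isGalois_adjoin_top isGalois_adjoin exists_ne_one restrictNormal_ne_one)
open Summit.BirchSwinnertonDyer.BirchSwinnertonDyer.Theorems.BiquadraticEisensteinDescentEisensteinHeartFlatCMInertBadKPrimeThetaRoute
  (not_dvd_discr_of_heegner)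
open Summit.BirchSwinnertonDyer.BirchSwinnertonDyer.Theorems.BiquadraticEisensteinDescentEisensteinHeartFlatCMInertBadKPrimeThetaRouteIm
  (exists_theta_datum_route_im)
open Summit.BirchSwinnertonDyer.BirchSwinnertonDyer.Theorems.BiquadraticEisensteinDescentEisensteinHeartFlatCMInertBadKPrimeBiquadraticCMField
  (isTotallyComplex_of_tower finrank_eq_four)
open Summit.BirchSwinnertonDyer.BirchSwinnertonDyer.Theorems.BiquadraticEisensteinDescentEisensteinHeartFlatCMInertBadKPrimeBiquadraticPrimes
  (not_isSquare_of_cmInert not_exists_sq_eq_of_split sqrt_not_mem_range)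
open Summit.BirchSwinnertonDyer.BirchSwinnertonDyer.Theorems.BiquadraticEisensteinDescentEisensteinHeartFlatCMInertBadKPrimeBiquadraticCMType
  (katz_frame_primes isCMField_of_split)
open Summit.BirchSwinnertonDyer.BirchSwinnertonDyer.Theorems.BiquadraticEisensteinDescentEisensteinHeartFlatCMInertBadKPrimeSigmaOrientation
  (inSigma_singleton_iff)
open Summit.BirchSwinnertonDyer.BirchSwinnertonDyer.Theorems.BiquadraticEisensteinDescentEisensteinHeartFlatCMInertBadKPrimeBiquadraticExists
  (isGalois_of_finrank_eq_two)
open Summit.BirchSwinnertonDyer.BirchSwinnertonDyer.Theorems.BiquadraticEisensteinDescentEisensteinHeartFlatCMInertBadKPrimeCuspCoeffVanishing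
  (cuspCoeff_eq_zero_of_hasCM_of_not_good dvd_conductorNorm_of_not_good)

namespace Summit.BirchSwinnertonDyer.BirchSwinnertonDyer.Theorems.BiquadraticEisensteinDescentEisensteinHeartFlatCMInertBadKPrimeTiedFrameData

open Summit.BirchSwinnertonDyer.BirchSwinnertonDyer.Theorems.BiquadraticEisensteinDescentEisensteinHeartFlatCMInertBadKPrimeTiedFrame
  (adjoin_eq_top_of_not_mem_range normCharacter_apply_eq_cpow_one restrictNormal_eq_of_ne_one)
open Summit.BirchSwinnertonDyer.BirchSwinnertonDyer.Theorems.BiquadraticEisensteinDescentEisensteinHeartFlatCMInertBadKPrimeDeuringTransport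
  (exists_deuringCharacter_of_hasCM exists_theta_datum_of_hasCM)
open Summit.BirchSwinnertonDyer.BirchSwinnertonDyer.Theorems.BiquadraticEisensteinDescentEisensteinHeartFlatCMInertBadKPrimeKatzFrameBookkeeping
  (exists_finset_S hS_of_mem hlam_of_mem hramS_of_mem exists_prime_mem_of_mem_D)
open Summit.BirchSwinnertonDyer.BirchSwinnertonDyer.Theorems.BiquadraticEisensteinDescentEisensteinHeartFlatCMInertBadKPrimeBranchUnramified
  (hunr_of_frame)
open Summit.BirchSwinnertonDyer.BirchSwinnertonDyer.Theorems.BiquadraticEisensteinDescentEisensteinHeartFlatCMInertBadKPrimeBranchBadPrimes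
  (not_isUnramifiedAt_compRelNorm_of_bad)
open Summit.BirchSwinnertonDyer.BirchSwinnertonDyer.Theorems.BiquadraticEisensteinDescentEisensteinHeartFlatCMInertBadKPrimeFrameCMSubfield
  (gen_sq)
open Summit.BirchSwinnertonDyer.BirchSwinnertonDyer.Theorems.BiquadraticEisensteinDescentEisensteinHeartFlatCMInertBadKPrimeBiquadraticExists
  (exists_quadratic_sqrt)

variable {K : Type} [Field K] [NumberField K] {L : Type} [Field L] [NumberField L] [Algebra K L]

/-! ### §1 The tied frame data at a given quadratic `L ⊇ K′` (no Katz measure) -/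

/-- **THE TIED FRAME DATA AT A GIVEN QUADRATIC `L ⊇ K′`** — `…TiedFrame.exists_tiedFrame_of_frame` WITHOUT its Katz binder and without
the Katz line series in the conclusion: for the item's data and the frame `L = K′(x)`, `x² = d_CM`, a Deuring character `ψ` of `ℚ⟮x⟯`
(type `(1,0)`, clause (iv) for `W`, `ψ∘N` ramified above the bad primes), the CM-field element `θ₀, a` and the (R)/S bookkeeping on `S`:
there are `𝔓′ ∣ 𝔭′`, `T ⊆ S`, Hsieh's `ϑ` and the two places `w₁ ≠ w₂` with (T) Katz type `(1; n, n−1)` on Hsieh's range, (C) entire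
continuation, (L) `L(λ·χ∘N, 0) = 1·1ⁿ·RS(f ⊗ χ, 1)`, (R) `λ` ramified on `S ∪ {w ∣ p}` and on `{𝔓′} ∪ T`, and `Im σ_w(ϑ) ≠ 0`
(`λ = ψ∘N_{L/ℚ⟮x⟯}·‖·‖_L`). Proof = the w3 g7 proof minus its last step. [cite: Hsieh2014mu, Prop. 4.9 (§4.8), §3.1, §4.1]
[cite: SilvermanATAEC1994, Ch. II Thm. 10.5 (b)] [cite: Washington1997, §13.1–13.2] -/
theorem exists_tiedFrameData_of_frame
    -- the item's binders
    (W : WeierstrassCurve ℚ) [W.IsElliptic] [W.IsGloballyMinimal] [NeZero (W.conductorNorm ℤ)]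
    {p : ℕ} [Fact p.Prime] (hCM : W.HasCM) (hp5 : 5 ≤ p) (hin : CMInert W p)
    (hbad : ¬ Good W p) (hK : IsImaginaryQuadratic K) (hHN : SatisfiesHeegnerHypothesis (W.conductorNorm ℤ) K)
    {𝔭 𝔭' : HeightOneSpectrum (𝓞 K)} (h𝔭 : ((p : ℕ) : 𝓞 K) ∈ 𝔭.asIdeal) (h𝔭' : ((p : ℕ) : 𝓞 K) ∈ 𝔭'.asIdeal)
    (hne : 𝔭' ≠ 𝔭) {f : CuspForm (Gamma0 (W.conductorNorm ℤ)) 2} (hf : IsNewformOf W f) {ι : PadicAlgCl p ≃+* ℂ}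
    (hι : ∀ (w : InfinitePlace K) (k : 𝓞 K), k ∈ 𝔭.asIdeal ↔ ‖ι.symm (w.embedding (k : K))‖ < 1)
    -- the frame `L = K′(x)`, `x² = d_CM` (Galois instances: `…BiquadraticExists.isGalois_of_finrank_eq_two`,
    -- `…FrameCMSubfield.isGalois_adjoin_top`)
    [IsGalois K L] (h2 : finrank K L = 2) {x : L} (hx : x ^ 2 = (cmFieldDiscrOfJ W.j : L)) [IsGalois ℚ⟮x⟯ L]
    -- a Hecke character of the CM field realised as `ℚ⟮x⟯ ⊆ L`: type `(1,0)`, Deuring (iv) for `W`, ramified above bad primes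
    (c : ℚ⟮x⟯ ≃ₐ[ℚ] ℚ⟮x⟯) (hc : c ≠ 1) {ψ : HeckeCharacter ℚ⟮x⟯}
    (hψ1 : ψ.HasInfinityType (fun _ ↦ 1) (fun _ ↦ 0))
    (hψ4 : ∀ (ℓ : ℕ) [Fact ℓ.Prime], W.HasGoodReductionAtPrime ℓ →
      ∀ 𝔮 : HeightOneSpectrum (𝓞 ℚ⟮x⟯), (ℓ : 𝓞 ℚ⟮x⟯) ∈ 𝔮.asIdeal →
        ψ.IsUnramifiedAt 𝔮 ∧
        (c • 𝔮 ≠ 𝔮 →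
          ψ.valueAtUniformizer 𝔮 + ψ.valueAtUniformizer (c • 𝔮) = (W.frobeniusTrace ℓ : ℂ) ∧
          ψ.valueAtUniformizer 𝔮 * ψ.valueAtUniformizer (c • 𝔮) = (ℓ : ℂ)) ∧
        (c • 𝔮 = 𝔮 → W.frobeniusTrace ℓ = 0 ∧ ψ.valueAtUniformizer 𝔮 = -(ℓ : ℂ)))
    (hψbad : ∀ (ℓ : ℕ) [Fact ℓ.Prime], ¬ W.HasGoodReductionAtPrime ℓ →
      ∀ w : HeightOneSpectrum (𝓞 L), (ℓ : 𝓞 L) ∈ w.asIdeal → ¬ (ψ.compRelNorm L).IsUnramifiedAt w)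
    -- the CM-field element of `…KatzHsiehLValueCM` (`…CMFieldTheta.exists_theta_datum`)
    (θ₀ : 𝓞 ℚ⟮x⟯) (a : ℤ) (hcθ : c • θ₀ = (a : 𝓞 ℚ⟮x⟯) - θ₀)
    (hθ : ∀ 𝔮 : HeightOneSpectrum (𝓞 ℚ⟮x⟯), Ideal.absNorm 𝔮.asIdeal = (Ideal.absNorm 𝔮.asIdeal).minFac ^ 2 →
      (a : 𝓞 ℚ⟮x⟯) - 2 * θ₀ ∉ 𝔮.asIdeal)
    (hθram : ∀ (ℓ : ℕ) [Fact ℓ.Prime] (𝔮 : HeightOneSpectrum (𝓞 ℚ⟮x⟯)), (ℓ : 𝓞 ℚ⟮x⟯) ∈ 𝔮.asIdeal →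
      (a : 𝓞 ℚ⟮x⟯) - 2 * θ₀ ∈ 𝔮.asIdeal → ¬ W.HasGoodReductionAtPrime ℓ)
    -- the (R)/S bookkeeping on `S` = primes of `L` above the bad `ℓ ≠ p` (`…KatzFrameBookkeeping`)
    (S : Finset (HeightOneSpectrum (𝓞 L)))
    (hSP : ∀ w ∈ S, ∃ ℓ ∈ (W.conductorNorm ℤ).primeFactors, ((ℓ : ℕ) : 𝓞 L) ∈ w.asIdeal)
    (hS : ∀ w ∈ S, ((p : ℕ) : 𝓞 L) ∉ w.asIdeal)
    (hlam : ∀ w : HeightOneSpectrum (𝓞 L), w ∉ S → ((p : ℕ) : 𝓞 L) ∉ w.asIdeal →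
      (ψ.compRelNorm L * HeckeCharacter.normCharacter L).IsUnramifiedAt w)
    (hramS : ∀ w ∈ S ∪ KatzCM.primesOver L p, ¬ (ψ.compRelNorm L * HeckeCharacter.normCharacter L).IsUnramifiedAt w) :
    ∃ (𝔓' : HeightOneSpectrum (𝓞 L)) (T : Finset (HeightOneSpectrum (𝓞 L))) (ϑ : L) (w₁ w₂ : InfinitePlace L),
      𝔓'.asIdeal.LiesOver 𝔭'.asIdeal ∧ T ⊆ S ∧
      w₁ ≠ w₂ ∧ (∀ w : InfinitePlace L, w = w₁ ∨ w = w₂) ∧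
      (∀ (χ : HeckeCharacter K) (n : ℕ), 0 < n → (∀ v : HeightOneSpectrum (𝓞 K), χ.IsUnramifiedAt v) →
        χ.HasInfinityType (fun _ ↦ (n : ℤ)) (fun _ ↦ -(n : ℤ)) →
        KatzCM.HasKatzType ι ({𝔓'} : Finset (HeightOneSpectrum (𝓞 L)))
          (ψ.compRelNorm L * HeckeCharacter.normCharacter L * χ.compRelNorm L) 1
          (fun w ↦ if w = w₁ then n else n - 1)) ∧
      (∀ (χ : HeckeCharacter K) (n : ℕ), 0 < n → (∀ v : HeightOneSpectrum (𝓞 K), χ.IsUnramifiedAt v) →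
        χ.HasInfinityType (fun _ ↦ (n : ℤ)) (fun _ ↦ -(n : ℤ)) →
        LFunction.HasEntireContinuation
          (heckeLFunction (ψ.compRelNorm L * HeckeCharacter.normCharacter L * χ.compRelNorm L))) ∧
      (1 : ℂ) ≠ 0 ∧ (1 : ℂ) ≠ 0 ∧
      (∀ (χ : HeckeCharacter K) (n : ℕ), 0 < n → (∀ v : HeightOneSpectrum (𝓞 K), χ.IsUnramifiedAt v) →
        χ.HasInfinityType (fun _ ↦ (n : ℤ)) (fun _ ↦ -(n : ℤ)) →
        ∀ hL : LFunction.HasEntireContinuation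
            (heckeLFunction (ψ.compRelNorm L * HeckeCharacter.normCharacter L * χ.compRelNorm L)),
          hL.continuation 0 = 1 * 1 ^ n * rankinSelbergValueHecke f χ 1) ∧
      (∀ w ∈ S ∪ KatzCM.primesOver L p, ¬ (ψ.compRelNorm L * HeckeCharacter.normCharacter L).IsUnramifiedAt w) ∧
      (∀ w ∈ ({𝔓'} : Finset (HeightOneSpectrum (𝓞 L))) ∪ T,
        ¬ (ψ.compRelNorm L * HeckeCharacter.normCharacter L).IsUnramifiedAt w) ∧
      (∀ w, (KatzCM.embeddingAt ι ({𝔓'} : Finset (HeightOneSpectrum (𝓞 L))) w ϑ).im ≠ 0) := by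
  have hp : p.Prime := Fact.out
  have hp2 : p ≠ 2 := by
    rintro rfl
    omega
  have hne' : 𝔭 ≠ 𝔭' := fun h ↦ hne h.symm
  -- arithmetic of the frame (`d := cmFieldDiscrOfJ W.j`)
  have hd : ¬ IsSquare ((cmFieldDiscrOfJ W.j : ℤ) : ZMod p) := not_isSquare_of_cmInert hp2 hin
  have hd0 : cmFieldDiscrOfJ W.j < 0 := by
    rcases Summit.BirchSwinnertonDyer.BirchSwinnertonDyer.Theorems.BiquadraticEisensteinDescentEisensteinHeartFlatCMInertBadKPrimeThetaRoute.cmFieldDiscrOfJ_mem_nine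
        W hCM with h | h | h | h | h | h | h | h | h <;> rw [h] <;> norm_num
  haveI : FiniteDimensional K L := Module.Finite.of_restrictScalars_finite ℚ K L
  have hxK : x ∉ Set.range (algebraMap K L) := sqrt_not_mem_range (not_exists_sq_eq_of_split hK.1 hd h𝔭 h𝔭' hne') hx
  have hxQ : x ∉ Set.range (algebraMap ℚ L) := not_mem_range_rat hxK
  haveI : IsCMField K := hK.isCMField
  haveI : IsCMField L := isCMField_of_split hK h2 hd0 hd hx h𝔭 h𝔭' hne'
  haveI : IsTotallyComplex K := hK.2
  haveI : IsTotallyComplex L := isTotallyComplex_of_tower (K := K)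
  haveI : IsGalois ℚ ℚ⟮x⟯ := isGalois_adjoin hx hxQ
  haveI : IsTotallyComplex ℚ⟮x⟯ := isTotallyComplex_adjoin hx hd0
  have h4 : finrank ℚ L = 4 := finrank_eq_four hK h2
  have h2K₁ : finrank ℚ ℚ⟮x⟯ = 2 := finrank_adjoin_eq_two hx hxQ
  have h2L₁ : finrank ℚ⟮x⟯ L = 2 := finrank_adjoin_top_eq_two hK h2 hx hxQ
  -- the primes above `p` in `L`; `Σ_p = {𝔓′}`; `p ∤ d_{L⁺}`
  obtain ⟨𝔓, 𝔓', h𝔓, h𝔓', hPP, hprimes, -, -, -, hSp', -, -⟩ :=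
    katz_frame_primes (p := p) hK h2 hd hx h𝔭 h𝔭' hne'
  haveI := h𝔓
  haveI := h𝔓'
  obtain ⟨xo, hxo, hxo2⟩ :=
    Summit.BirchSwinnertonDyer.BirchSwinnertonDyer.Theorems.BiquadraticEisensteinDescentEisensteinHeartFlatCMInertBadKPrimeBiquadraticPrimes.exists_ringOfIntegers_sq_eq
      hx
  -- orientation of `Σ` by the `𝔭`-compatible embedding `φ₀`
  obtain ⟨v₀⟩ : Nonempty (InfinitePlace K) := inferInstance
  have hι₀ : ∀ k : 𝓞 K, k ∈ 𝔭.asIdeal ↔ ‖ι.symm (v₀.embedding (k : K))‖ < 1 := fun k ↦ hι v₀ k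
  have hSig : ∀ σ : L →+* ℂ, KatzCM.InSigma ι ({𝔓'} : Finset (HeightOneSpectrum (𝓞 L))) σ ↔
      σ.comp (algebraMap K L) = ComplexEmbedding.conjugate v₀.embedding :=
    fun σ ↦ inSigma_singleton_iff (𝔓 := 𝔓) (𝔓' := 𝔓') hK h4 hd hxo2 h𝔭 h𝔭' hne' hι₀ σ
  -- (T) and (C)
  obtain ⟨w₁, w₂, hw, huniv, hT, hcont⟩ := exists_hT_hcont_adjoin hK h2 hx hd0 hxK hSp' hSig hψ1
  -- the conjugation datum
  obtain ⟨τ, hτ⟩ := exists_ne_one (K := K) (L := L) h2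
  have hτc : (τ.restrictScalars ℚ).restrictNormal ℚ⟮x⟯ = c := restrictNormal_eq_of_ne_one h2 hx hxK τ hτ c hc
  -- (L)
  have hLval := hLval_of_deuring_of_cmField (K := K) (L := L) (ι := ι) hSp' W hCM c hψ1 hψ4 hψbad hf h2K₁ hK.1 h2
    h2L₁ hτ hτc θ₀ a hcθ hθ hθram (ν := HeckeCharacter.normCharacter L) normCharacter_apply_eq_cpow_one hT
  -- Hsieh's `ϑ`, the sets `D`, `T`, and the non-vanishing `Im σ(ϑ) ≠ 0`
  have hgen : Algebra.adjoin K {x} = ⊤ := adjoin_eq_top_of_not_mem_range h2 hxK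
  obtain ⟨ϑ, _D, T, -, -, hIm, hTS, -, -, -, -, -, -, -⟩ :=
    exists_theta_datum_route_im W p K hCM hbad hK hHN L h2.le hgen hx v₀.embedding (ι := ι)
      (Sp := ({𝔓'} : Finset (HeightOneSpectrum (𝓞 L)))) (fun σ hσ ↦ (hSig σ).mp hσ) S hSP
  -- (R) on `Σ_p ∪ T`
  have hramT : ∀ w ∈ ({𝔓'} : Finset (HeightOneSpectrum (𝓞 L))) ∪ T,
      ¬ (ψ.compRelNorm L * HeckeCharacter.normCharacter L).IsUnramifiedAt w := by
    intro w hw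
    rcases Finset.mem_union.mp hw with h | h
    · rw [Finset.mem_singleton] at h
      subst h
      exact hramS _ (Finset.mem_union_right _ (by rw [hprimes]; simp))
    · exact hramS _ (Finset.mem_union_left _ (hTS h))
  exact ⟨𝔓', T, ϑ, w₁, w₂, h𝔓', hTS, hw, huniv, hT, hcont, one_ne_zero, one_ne_zero, hLval, hramS, hramT, fun w ↦ hIm _⟩

/-! ### §2 The tied frame data for the crux (the field, the character, the bookkeeping), unconditionally -/

/-- **THE TIED FRAME DATA OF `stub_V2`, WITHOUT THE KATZ MEASURE AND WITH DEURING DISCHARGED** — the registered signature of v3's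
`stub_V2` with the Katz line series `G`, its constants `(C_K, Ω, Ω′_p)` and the conjunct `KatzCM.IsBaseChangeLine …` REMOVED from
the conclusion, proved UNCONDITIONALLY: `…StubV2AllJ.stub_V2_of_katz_of_deuring`'s assembly verbatim (field `L = K′(√d_CM)`, Deuring's
character for `W` via the isogenous maximal-order model — all thirteen CM `j` —, `S`, the (R)/S bookkeeping, the CM-field element) with
Deuring's theorem supplied by `…DeuringOfCore.Deuring_exists_heckeCharacter_of_maximalCM_holds` and the last step replaced by §1.
[cite: Hsieh2014mu, Prop. 4.9 (§4.8)] [cite: SilvermanATAEC1994, Ch. II Thm. 9.2 and Thm. 10.5 (b)] -/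
theorem exists_tiedFrameData :
    ∀ (W : WeierstrassCurve ℚ) [W.IsElliptic] [W.IsGloballyMinimal] (p : ℕ) [Fact p.Prime]
      [NeZero (W.conductorNorm ℤ)] (K : Type) [Field K] [NumberField K],
      W.HasCM → 5 ≤ p → CMInert W p → ¬ Good W p →
      IsImaginaryQuadratic K → SatisfiesHeegnerHypothesis (W.conductorNorm ℤ) K →
      4 < (NumberField.discr K).natAbs → ¬ p ∣ NumberField.classNumber K →
      ∀ (κ : ZpExtension K p), κ.IsAnticyclotomic →
        ∀ (γ : Field.absoluteGaloisGroup K) [Fact (κ.IsTopGenerator γ)]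
          (𝔭 : HeightOneSpectrum (𝓞 K)), ((p : ℕ) : 𝓞 K) ∈ 𝔭.asIdeal →
          𝔭.asIdeal.ramificationIdx (𝓞 ℚ) = 1 → 𝔭.asIdeal.inertiaDeg (𝓞 ℚ) = 1 →
          ∀ (f : CuspForm (CongruenceSubgroup.Gamma0 (W.conductorNorm ℤ)) 2), IsNewformOf W f →
            ∀ (ι' : PadicAlgCl p ≃+* ℂ),
              (∀ (w : InfinitePlace K) (k : 𝓞 K), k ∈ 𝔭.asIdeal ↔ ‖ι'.symm (w.embedding (k : K))‖ < 1) →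
                  ∀ (𝔭' : HeightOneSpectrum (𝓞 K)), ((p : ℕ) : 𝓞 K) ∈ 𝔭'.asIdeal → 𝔭' ≠ 𝔭 →
                  ∃ (L : Type) (_ : Field L) (_ : NumberField L) (_ : Algebra K L) (_ : IsGalois K L)
                    (Sp S T : Finset (HeightOneSpectrum (𝓞 L))) (lam : HeckeCharacter L) (ϑ : L)
                    (w₁ w₂ : InfinitePlace L) (cL cL' : ℂ),
                    w₁ ≠ w₂ ∧ (∀ w : InfinitePlace L, w = w₁ ∨ w = w₂) ∧
                    (∀ (χ : HeckeCharacter K) (n : ℕ), 0 < n → (∀ v : HeightOneSpectrum (𝓞 K), χ.IsUnramifiedAt v) →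
                      χ.HasInfinityType (fun _ ↦ (n : ℤ)) (fun _ ↦ -(n : ℤ)) →
                      KatzCM.HasKatzType ι' Sp (lam * χ.compRelNorm L) 1 (fun w ↦ if w = w₁ then n else n - 1)) ∧
                    (∀ (χ : HeckeCharacter K) (n : ℕ), 0 < n → (∀ v : HeightOneSpectrum (𝓞 K), χ.IsUnramifiedAt v) →
                      χ.HasInfinityType (fun _ ↦ (n : ℤ)) (fun _ ↦ -(n : ℤ)) →
                      LFunction.HasEntireContinuation (heckeLFunction (lam * χ.compRelNorm L))) ∧
                    cL ≠ 0 ∧ cL' ≠ 0 ∧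
                    (∀ (χ : HeckeCharacter K) (n : ℕ), 0 < n → (∀ v : HeightOneSpectrum (𝓞 K), χ.IsUnramifiedAt v) →
                      χ.HasInfinityType (fun _ ↦ (n : ℤ)) (fun _ ↦ -(n : ℤ)) →
                      ∀ hL : LFunction.HasEntireContinuation (heckeLFunction (lam * χ.compRelNorm L)),
                        hL.continuation 0 = cL * cL' ^ n * rankinSelbergValueHecke f χ 1) ∧
                    (∀ w ∈ S ∪ KatzCM.primesOver L p, ¬ lam.IsUnramifiedAt w) ∧
                    (∀ w ∈ Sp ∪ T, ¬ lam.IsUnramifiedAt w) ∧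
                    (∀ w, (KatzCM.embeddingAt ι' Sp w ϑ).im ≠ 0) := by
  intro W _ _ p _ _ K _ _ hCM hp5 hin hbad hK hHN _hd4 _hh _κ _hκ _γ _ 𝔭 h𝔭 _he _hf1 f hf ι' hι 𝔭' h𝔭' hne
  have hp2 : p ≠ 2 := by
    rintro rfl
    omega
  have hne' : 𝔭 ≠ 𝔭' := fun h ↦ hne h.symm
  have hd : ¬ IsSquare ((cmFieldDiscrOfJ W.j : ℤ) : ZMod p) := not_isSquare_of_cmInert hp2 hin
  have hdK : ¬ ∃ y : K, y ^ 2 = (cmFieldDiscrOfJ W.j : K) := not_exists_sq_eq_of_split hK.1 hd h𝔭 h𝔭' hne'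
  -- the field `L = K′(√d_CM)` and the CM field `ℚ⟮x⟯ ⊆ L`
  obtain ⟨L, _, _, _, h2, x, hx⟩ := exists_quadratic_sqrt K (cmFieldDiscrOfJ W.j) hdK
  haveI : IsGalois K L := isGalois_of_finrank_eq_two h2
  have hxK : x ∉ Set.range (algebraMap K L) := sqrt_not_mem_range hdK hx
  have hxQ : x ∉ Set.range (algebraMap ℚ L) := not_mem_range_rat hxK
  haveI : IsGalois ℚ⟮x⟯ L := isGalois_adjoin_top hK h2 hx hxQ
  haveI : IsGalois ℚ ℚ⟮x⟯ := isGalois_adjoin hx hxQ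
  have h2K₁ : finrank ℚ ℚ⟮x⟯ = 2 := finrank_adjoin_eq_two hx hxQ
  have hθ : ∃ θ : ℚ⟮x⟯, θ ^ 2 = (cmFieldDiscrOfJ W.j : ℚ⟮x⟯) := ⟨AdjoinSimple.gen ℚ x, gen_sq hx⟩
  -- the conjugation `c` of `ℚ⟮x⟯`
  obtain ⟨τ, hτ⟩ := exists_ne_one (K := K) (L := L) h2
  have hc : (τ.restrictScalars ℚ).restrictNormal ℚ⟮x⟯ ≠ 1 := restrictNormal_ne_one h2 hx hxK τ hτ
  -- Deuring's character for `W` itself (all thirteen CM `j`, via the isogenous maximal-order model `W₁`)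
  obtain ⟨W₁, _, _, hiso, hj₁, _, hK₁, ψ, hψ1, -, -, hψ3₁, hψ4, -⟩ :=
    exists_deuringCharacter_of_hasCM
      Summit.BirchSwinnertonDyer.BirchSwinnertonDyer.Theorems.BiquadraticEisensteinDescentDeuringOfCore.Deuring_exists_heckeCharacter_of_maximalCM_holds
      W hCM h2K₁ hθ _ hc
  -- the bad primes of `W`, `W₁` are prime to `d_{K′}` (Heegner), `L/ℚ⟮x⟯` is unramified above them, `ψ ∘ N` is ramified there
  obtain ⟨-, -, δ, -, hδ⟩ := Literature.NumberTheory.QuadraticFields.Quadratic.exists_sq_eq_discr (K := K) hK.1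
  have hbadK₁ : ∀ (ℓ : ℕ) [Fact ℓ.Prime], ¬ W₁.HasGoodReductionAtPrime ℓ → ¬ (ℓ : ℤ) ∣ NumberField.discr K := by
    intro ℓ hℓ hℓbad
    refine not_dvd_discr_of_heegner hK hHN hℓ.out ((W.dvd_conductorNorm_iff_not_hasGoodReductionAtPrime ℓ).mpr ?_)
    exact fun hg ↦ hℓbad ((hiso.hasGoodReductionAtPrime_iff ℓ).mp hg)
  have hunr₁ := hunr_of_frame hK h2 hx hxK hδ W₁ hbadK₁
  have hψbad : ∀ (ℓ : ℕ) [Fact ℓ.Prime], ¬ W.HasGoodReductionAtPrime ℓ →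
      ∀ w : HeightOneSpectrum (𝓞 L), (ℓ : 𝓞 L) ∈ w.asIdeal → ¬ (ψ.compRelNorm L).IsUnramifiedAt w := by
    intro ℓ hℓ hℓbad w hw
    exact not_isUnramifiedAt_compRelNorm_of_bad W₁ hj₁ hK₁ hψ3₁ hunr₁ ℓ
      (fun hg ↦ hℓbad ((hiso.hasGoodReductionAtPrime_iff ℓ).mpr hg)) w hw
  -- the CM-field element
  obtain ⟨θ₀, a, hcθ, hθ', hθram⟩ := exists_theta_datum_of_hasCM W hCM h2K₁ hθ hc
  -- the set `S` of primes of `L` above the bad `ℓ ≠ p` and its bookkeeping (on `W₁`)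
  obtain ⟨S, hSmem⟩ := exists_finset_S (L := L) W₁ p
  have hbad₁ : ¬ W₁.HasGoodReductionAtPrime p := fun hg ↦ hbad ((hiso.hasGoodReductionAtPrime_iff p).mpr hg)
  have hS : ∀ w ∈ S, ((p : ℕ) : 𝓞 L) ∉ w.asIdeal := hS_of_mem W₁ p hSmem
  have hlam : ∀ w : HeightOneSpectrum (𝓞 L), w ∉ S → ((p : ℕ) : 𝓞 L) ∉ w.asIdeal →
      (ψ.compRelNorm L * HeckeCharacter.normCharacter L).IsUnramifiedAt w := hlam_of_mem p hSmem hj₁ hK₁ hψ3₁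
  have hramS : ∀ w ∈ S ∪ KatzCM.primesOver L p,
      ¬ (ψ.compRelNorm L * HeckeCharacter.normCharacter L).IsUnramifiedAt w :=
    hramS_of_mem p hSmem hj₁ hK₁ hψ3₁ hbad₁ hunr₁
  have hSP : ∀ w ∈ S, ∃ ℓ ∈ (W.conductorNorm ℤ).primeFactors, ((ℓ : ℕ) : 𝓞 L) ∈ w.asIdeal := by
    intro w hw
    obtain ⟨ℓ, hℓ, hℓw, hℓbad⟩ := exists_prime_mem_of_mem_D W₁ p hSmem (Finset.mem_union_right _ hw)
    have hbadℓ : ¬ W.HasGoodReductionAtPrime ℓ := by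
      rcases hℓbad with rfl | h
      · exact hbad
      · exact fun hg ↦ h ((hiso.hasGoodReductionAtPrime_iff ℓ).mp hg)
    exact ⟨ℓ, Nat.mem_primeFactors.mpr
      ⟨hℓ.out, (W.dvd_conductorNorm_iff_not_hasGoodReductionAtPrime ℓ).mpr hbadℓ, NeZero.ne _⟩, hℓw⟩
  -- the tied frame
  obtain ⟨𝔓', T, ϑ, w₁, w₂, -, -, hrest⟩ :=
    exists_tiedFrameData_of_frame W hCM hp5 hin hbad hK hHN h𝔭 h𝔭' hne hf hι h2 hx _ hc hψ1 hψ4 hψbad θ₀ a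
      hcθ hθ' hθram S hSP hS hlam hramS
  exact ⟨L, _, _, _, _, {𝔓'}, S, T, ψ.compRelNorm L * HeckeCharacter.normCharacter L, ϑ, w₁, w₂, 1, 1, hrest⟩


end Summit.BirchSwinnertonDyer.BirchSwinnertonDyer.Theorems.BiquadraticEisensteinDescentEisensteinHeartFlatCMInertBadKPrimeTiedFrameData

end
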